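import Summits.SmoothPoincare4.SmoothPoincare4.Theorems.EntropyRungSubcylindricalExistenceAnnulusConeFloorModel
import Summits.SmoothPoincare4.SmoothPoincare4.Theorems.EntropyRungSubcylindricalExistenceRoundClauseEuclidean
import HarnessLib

/-!
# The exact-cone floor on `ℝ⁴ ∖ {0}` in the `x`-picture (vertex at the origin)
(aux for stub `helper_annulusConeFloor`, line `fat-conical-core-avr-logsobolev`, crux
`EntropyRung.SubcylindricalExistence`, stmt-SmoothPoincare4-10871)

From the Euclidean reading of the log-Sobolev inequality of the exact cone `(c'‖x‖^{c'−1})² δ`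
near infinity (`helper_helper_annulusConeFloor_model`:
`∫ u² log u² ψ⁴ ≤ 4τ ∫ ψ⁻²‖∇u‖² ψ⁴ − 3 log c' − 2 log(4πτ) − 4` for `∫ u² ψ⁴ = 1`,
`tsupport u ⊆ {1 < ‖x‖}`, `ψ = c'‖x‖^{c'−1}`) we derive Perelman's `𝒲`-clause in `w²`-form for the
weight `ψ`: substituting `u = (4πτ)⁻¹ w` the term `−2 log(4πτ)` cancels and
`3 log c' ≤ ∫ [4τ ψ⁻² ‖∇w‖² − w² log w² − 4w²] (4πτ)⁻² ψ⁴ dx` (`coneFloor_far`); the cone weight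
being homogeneous, `ψ(l y) = l^{c'−1} ψ(y)`, the clause is invariant under the dilations
`w ↦ w(l ·)`, `τ ↦ τ l^{−2c'}` (`coneFloor_dilate`, Lebesgue measure scales by `l⁴`,
`∇(w(l ·)) = l (∇w)(l ·)`), which removes the restriction to `{1 < ‖x‖}`: the registered helper
`helper_helper_annulusConeFloor_cone` states the floor for all smooth compactly supported `w`
with `tsupport w ⊆ {a ≤ ‖x‖}`, `a > 0`. Everything is proved; no definition, no named fact.

References: Z. M. Balogh, A. Kristály, F. Tripaldi, J. Funct. Anal. 286 (2024), Thm. 1.1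
[BaloghKristalyTripaldi2024]; G. Perelman, arXiv:math/0211159, §3.1 [Perelman2002Entropy].
-/

noncomputable section

open scoped Manifold ContDiff Topology ENNReal NNReal RealInnerProductSpace
open Set Filter Function MeasureTheory InnerProductSpace
open Literature.Geometry.Lorentzian

-- the registered namespace `Summit.SmoothPoincare4.SmoothPoincare4.Theorems` repeats a component
set_option linter.dupNamespace false

namespace Summit.SmoothPoincare4.SmoothPoincare4.Theorems

namespace AnnulusConeFloor

section Far

variable {c' : ℝ} (hc' : 0 < c')
  (hLSe : ∀ u : EuclideanSpace ℝ (Fin 4) → ℝ, ContDiff ℝ ∞ u → HasCompactSupport u →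
    tsupport u ⊆ {x | 1 < ‖x‖} →
    ∫ x, (u x) ^ 2 * (c' * ‖x‖ ^ (c' - 1)) ^ 4 = 1 → ∀ τ : ℝ, 0 < τ →
      ∫ x, (u x) ^ 2 * Real.log ((u x) ^ 2) * (c' * ‖x‖ ^ (c' - 1)) ^ 4 ≤
        4 * τ * (∫ x, (c' * ‖x‖ ^ (c' - 1))⁻¹ ^ 2 * ‖gradient u x‖ ^ 2 *
            (c' * ‖x‖ ^ (c' - 1)) ^ 4)
          - 3 * Real.log c' - 2 * Real.log (4 * Real.pi * τ) - 4)

include hc' hLSe in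
/-- **The exact-cone floor near infinity (`w²`-form).** For `w` smooth, compactly supported in
`{1 < ‖x‖}` with `∫ (4πτ)⁻² w² ψ⁴ dx = 1` (`ψ = c'‖x‖^{c'−1}`):
`3 log c' ≤ ∫ [4τ ψ⁻² ‖∇w‖² − w² log w² − 4 w²] (4πτ)⁻² ψ⁴ dx` — the log-Sobolev inequality for
`u = (4πτ)⁻¹ w`, the term `−2 log(4πτ)` cancelling. [cite: BaloghKristalyTripaldi2024, Thm. 1.1] -/
theorem coneFloor_far {w : EuclideanSpace ℝ (Fin 4) → ℝ} (hw : ContDiff ℝ ∞ w)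
    (hwc : HasCompactSupport w) (hws : tsupport w ⊆ {x | 1 < ‖x‖}) {τ : ℝ} (hτ : 0 < τ)
    (hnorm : ∫ x, (4 * Real.pi * τ) ^ (-(4 : ℝ) / 2) * (w x) ^ 2 * (c' * ‖x‖ ^ (c' - 1)) ^ 4 = 1) :
    3 * Real.log c' ≤
      ∫ x, (4 * τ * ((c' * ‖x‖ ^ (c' - 1))⁻¹ ^ 2 * ‖gradient w x‖ ^ 2)
          - (w x) ^ 2 * Real.log ((w x) ^ 2) - 4 * (w x) ^ 2)
          * ((4 * Real.pi * τ) ^ (-(4 : ℝ) / 2) * (c' * ‖x‖ ^ (c' - 1)) ^ 4) := by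
  have h4 : 0 < 4 * Real.pi * τ := by positivity
  have hka : (4 * Real.pi * τ) ^ (-(4 : ℝ) / 2) = ((4 * Real.pi * τ)⁻¹) ^ 2 := gaussNorm_eq hτ
  have hk0 : 0 < (4 * Real.pi * τ) ^ (-(4 : ℝ) / 2) := Real.rpow_pos_of_pos h4 _
  have hlogk : Real.log ((4 * Real.pi * τ) ^ (-(4 : ℝ) / 2)) = -2 * Real.log (4 * Real.pi * τ) := by
    rw [hka, Real.log_pow, Real.log_inv]
    push_cast
    ring
  have hU : IsOpen {x : EuclideanSpace ℝ (Fin 4) | 1 < ‖x‖} := isOpen_lt continuous_const continuous_norm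
  have hψc := continuousOn_coneWeight c'
  have hψ0 : ∀ x ∈ {x : EuclideanSpace ℝ (Fin 4) | 1 < ‖x‖}, c' * ‖x‖ ^ (c' - 1) ≠ 0 := fun x hx ↦
    (coneWeight_pos hc' (by rintro rfl; norm_num at hx)).ne'
  have hwc' : Continuous w := hw.continuous
  have hgc : Continuous (gradient w) :=
    (InnerProductSpace.toDual ℝ (EuclideanSpace ℝ (Fin 4))).symm.continuous.comp
      (hw.continuous_fderiv (by simp))
  -- the three integrable pieces
  have hf₁ : Integrable fun x ↦ (c' * ‖x‖ ^ (c' - 1))⁻¹ ^ 2 * ‖gradient w x‖ ^ 2 *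
      ((4 * Real.pi * τ) ^ (-(4 : ℝ) / 2) * (c' * ‖x‖ ^ (c' - 1)) ^ 4) := by
    have h := integrable_mul_of_support_subset hU hwc hws (A := fun x ↦ ‖gradient w x‖ ^ 2)
      (B := fun x ↦ (c' * ‖x‖ ^ (c' - 1))⁻¹ ^ 2 *
        ((4 * Real.pi * τ) ^ (-(4 : ℝ) / 2) * (c' * ‖x‖ ^ (c' - 1)) ^ 4))
      (hgc.norm.pow 2) (fun x hx ↦ support_gradient_subset w fun h ↦ hx (by simp [h]))
      (((hψc.inv₀ hψ0).pow 2).mul (continuousOn_const.mul (hψc.pow 4)))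
    exact h.congr (ae_of_all _ fun x ↦ by ring)
  have hf₂ : Integrable fun x ↦ (w x) ^ 2 * Real.log ((w x) ^ 2) *
      ((4 * Real.pi * τ) ^ (-(4 : ℝ) / 2) * (c' * ‖x‖ ^ (c' - 1)) ^ 4) :=
    integrable_mul_of_support_subset hU hwc hws (A := fun x ↦ (w x) ^ 2 * Real.log ((w x) ^ 2))
      (Real.continuous_mul_log.comp (hwc'.pow 2))
      (fun x hx ↦ subset_tsupport _ fun h ↦ hx (by simp [h]))
      (continuousOn_const.mul (hψc.pow 4))
  have hf₃ : Integrable fun x ↦ (w x) ^ 2 *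
      ((4 * Real.pi * τ) ^ (-(4 : ℝ) / 2) * (c' * ‖x‖ ^ (c' - 1)) ^ 4) :=
    integrable_mul_of_support_subset hU hwc hws (A := fun x ↦ (w x) ^ 2) (hwc'.pow 2)
      (fun x hx ↦ subset_tsupport _ fun h ↦ hx (by simp [h]))
      (continuousOn_const.mul (hψc.pow 4))
  have hI₃ : ∫ x, (w x) ^ 2 * ((4 * Real.pi * τ) ^ (-(4 : ℝ) / 2) * (c' * ‖x‖ ^ (c' - 1)) ^ 4) = 1 :=
    (integral_congr_ae (ae_of_all _ fun x ↦ by ring)).trans hnorm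
  -- the function `u = (4πτ)⁻¹ w`
  have hu : ContDiff ℝ ∞ fun x ↦ (4 * Real.pi * τ)⁻¹ * w x := contDiff_const.mul hw
  have huc : HasCompactSupport fun x ↦ (4 * Real.pi * τ)⁻¹ * w x := hwc.mul_left
  have hus : tsupport (fun x ↦ (4 * Real.pi * τ)⁻¹ * w x) ⊆ {x | 1 < ‖x‖} :=
    (tsupport_mul_subset_right (f := fun _ ↦ (4 * Real.pi * τ)⁻¹) (g := w)).trans hws
  have hu2 : ∀ x, ((4 * Real.pi * τ)⁻¹ * w x) ^ 2 = (4 * Real.pi * τ) ^ (-(4 : ℝ) / 2) * (w x) ^ 2 := by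
    intro x
    rw [hka]
    ring
  have hgu : ∀ x, gradient (fun y ↦ (4 * Real.pi * τ)⁻¹ * w y) x = (4 * Real.pi * τ)⁻¹ • gradient w x :=
    fun x ↦ CapClauseEuclideanSchwarzschildAux.gradient_const_mul (hw.differentiable (by simp) x) _
  have hnorm_u : ∫ x, ((4 * Real.pi * τ)⁻¹ * w x) ^ 2 * (c' * ‖x‖ ^ (c' - 1)) ^ 4 = 1 :=
    (integral_congr_ae (ae_of_all _ fun x ↦ by simp only [hu2])).trans hnorm
  have key := hLSe _ hu huc hus hnorm_u τ hτ
  -- read the two sides of `key` on `w`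
  have hL : ∫ x, ((4 * Real.pi * τ)⁻¹ * w x) ^ 2 * Real.log (((4 * Real.pi * τ)⁻¹ * w x) ^ 2) *
      (c' * ‖x‖ ^ (c' - 1)) ^ 4 =
      (∫ x, (w x) ^ 2 * Real.log ((w x) ^ 2) *
        ((4 * Real.pi * τ) ^ (-(4 : ℝ) / 2) * (c' * ‖x‖ ^ (c' - 1)) ^ 4))
      + Real.log ((4 * Real.pi * τ) ^ (-(4 : ℝ) / 2)) *
        ∫ x, (w x) ^ 2 * ((4 * Real.pi * τ) ^ (-(4 : ℝ) / 2) * (c' * ‖x‖ ^ (c' - 1)) ^ 4) := by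
    rw [← integral_const_mul, ← integral_add hf₂ (hf₃.const_mul _)]
    refine integral_congr_ae (ae_of_all _ fun x ↦ ?_)
    simp only [hu2]
    by_cases hx : w x = 0
    · simp [hx]
    · rw [Real.log_mul hk0.ne' (pow_ne_zero 2 hx)]
      ring
  have hR : ∫ x, (c' * ‖x‖ ^ (c' - 1))⁻¹ ^ 2 *
      ‖gradient (fun y ↦ (4 * Real.pi * τ)⁻¹ * w y) x‖ ^ 2 * (c' * ‖x‖ ^ (c' - 1)) ^ 4 =
      ∫ x, (c' * ‖x‖ ^ (c' - 1))⁻¹ ^ 2 * ‖gradient w x‖ ^ 2 *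
        ((4 * Real.pi * τ) ^ (-(4 : ℝ) / 2) * (c' * ‖x‖ ^ (c' - 1)) ^ 4) := by
    refine integral_congr_ae (ae_of_all _ fun x ↦ ?_)
    simp only [hgu, norm_smul, Real.norm_of_nonneg (inv_pos.2 h4).le, mul_pow, hka]
    ring
  rw [hL, hR, hI₃, hlogk] at key
  -- assemble
  have hsplit : ∫ x, (4 * τ * ((c' * ‖x‖ ^ (c' - 1))⁻¹ ^ 2 * ‖gradient w x‖ ^ 2)
      - (w x) ^ 2 * Real.log ((w x) ^ 2) - 4 * (w x) ^ 2)
      * ((4 * Real.pi * τ) ^ (-(4 : ℝ) / 2) * (c' * ‖x‖ ^ (c' - 1)) ^ 4) =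
      4 * τ * (∫ x, (c' * ‖x‖ ^ (c' - 1))⁻¹ ^ 2 * ‖gradient w x‖ ^ 2 *
        ((4 * Real.pi * τ) ^ (-(4 : ℝ) / 2) * (c' * ‖x‖ ^ (c' - 1)) ^ 4))
      - (∫ x, (w x) ^ 2 * Real.log ((w x) ^ 2) *
        ((4 * Real.pi * τ) ^ (-(4 : ℝ) / 2) * (c' * ‖x‖ ^ (c' - 1)) ^ 4))
      - 4 * ∫ x, (w x) ^ 2 * ((4 * Real.pi * τ) ^ (-(4 : ℝ) / 2) * (c' * ‖x‖ ^ (c' - 1)) ^ 4) := by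
    have h : ∫ x, (4 * τ * ((c' * ‖x‖ ^ (c' - 1))⁻¹ ^ 2 * ‖gradient w x‖ ^ 2)
        - (w x) ^ 2 * Real.log ((w x) ^ 2) - 4 * (w x) ^ 2)
        * ((4 * Real.pi * τ) ^ (-(4 : ℝ) / 2) * (c' * ‖x‖ ^ (c' - 1)) ^ 4) =
        ∫ x, (4 * τ * ((c' * ‖x‖ ^ (c' - 1))⁻¹ ^ 2 * ‖gradient w x‖ ^ 2 *
          ((4 * Real.pi * τ) ^ (-(4 : ℝ) / 2) * (c' * ‖x‖ ^ (c' - 1)) ^ 4))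
          - (w x) ^ 2 * Real.log ((w x) ^ 2) *
            ((4 * Real.pi * τ) ^ (-(4 : ℝ) / 2) * (c' * ‖x‖ ^ (c' - 1)) ^ 4)
          - 4 * ((w x) ^ 2 * ((4 * Real.pi * τ) ^ (-(4 : ℝ) / 2) * (c' * ‖x‖ ^ (c' - 1)) ^ 4))) :=
      integral_congr_ae (ae_of_all _ fun x ↦ by ring)
    rw [h, integral_sub, integral_sub, integral_const_mul, integral_const_mul]
    · exact hf₁.const_mul _
    · exact hf₂
    · exact (hf₁.const_mul _).sub hf₂
    · exact hf₃.const_mul _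
  rw [hsplit, hI₃]
  linarith


end Far

/-- **Dilation covariance of the cone clause.** If the `w²`-clause of the weight
`ψ = c'‖x‖^{c'−1}` at level `3 log c'` holds for all scales and all smooth compactly supported `w`
with `tsupport w ⊆ {1 < ‖x‖}`, then it holds for `tsupport w ⊆ {a ≤ ‖x‖}`, any `a > 0`: apply it
to `W = w(l ·)`, `l = a/2`, at the scale `τ/(l·l^{c'−1})²` and undo the dilation
(`dx ↦ l⁴ dx`, `∇W = l (∇w)(l ·)`, `ψ(l y) = l^{c'−1} ψ(y)`). [cite: Perelman2002Entropy, §3.1] -/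
theorem coneFloor_dilate {c' : ℝ} (hc' : 0 < c')
    (hfar : ∀ τ : ℝ, 0 < τ → ∀ w : EuclideanSpace ℝ (Fin 4) → ℝ, ContDiff ℝ ∞ w →
      HasCompactSupport w → tsupport w ⊆ {x | 1 < ‖x‖} →
      ∫ x, (4 * Real.pi * τ) ^ (-(4 : ℝ) / 2) * (w x) ^ 2 * (c' * ‖x‖ ^ (c' - 1)) ^ 4 = 1 →
        3 * Real.log c' ≤
          ∫ x, (4 * τ * ((c' * ‖x‖ ^ (c' - 1))⁻¹ ^ 2 * ‖gradient w x‖ ^ 2)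
              - (w x) ^ 2 * Real.log ((w x) ^ 2) - 4 * (w x) ^ 2)
              * ((4 * Real.pi * τ) ^ (-(4 : ℝ) / 2) * (c' * ‖x‖ ^ (c' - 1)) ^ 4))
    {a : ℝ} (ha : 0 < a) {τ : ℝ} (hτ : 0 < τ) {w : EuclideanSpace ℝ (Fin 4) → ℝ}
    (hw : ContDiff ℝ ∞ w) (hwc : HasCompactSupport w) (hws : tsupport w ⊆ {x | a ≤ ‖x‖})
    (hnorm : ∫ x, (4 * Real.pi * τ) ^ (-(4 : ℝ) / 2) * (w x) ^ 2 * (c' * ‖x‖ ^ (c' - 1)) ^ 4 = 1) :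
    3 * Real.log c' ≤
      ∫ x, (4 * τ * ((c' * ‖x‖ ^ (c' - 1))⁻¹ ^ 2 * ‖gradient w x‖ ^ 2)
          - (w x) ^ 2 * Real.log ((w x) ^ 2) - 4 * (w x) ^ 2)
          * ((4 * Real.pi * τ) ^ (-(4 : ℝ) / 2) * (c' * ‖x‖ ^ (c' - 1)) ^ 4) := by
  -- the dilation factor `l = a / 2`, `L = l^{c'-1}`, the new scale `σ = τ / (l L)²`
  set l : ℝ := a / 2 with hl
  have hl0 : 0 < l := by positivity
  set L : ℝ := l ^ (c' - 1) with hL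
  have hL0 : 0 < L := Real.rpow_pos_of_pos hl0 _
  set σ : ℝ := τ / (l * L) ^ 2 with hσ
  have hσ0 : 0 < σ := by positivity
  have h4τ : 0 < 4 * Real.pi * τ := by positivity
  have hkσ : (4 * Real.pi * σ) ^ (-(4 : ℝ) / 2) = (4 * Real.pi * τ) ^ (-(4 : ℝ) / 2) * (l * L) ^ 4 := by
    rw [gaussNorm_eq hσ0, gaussNorm_eq hτ, hσ]
    field_simp
  have hψl : ∀ y : EuclideanSpace ℝ (Fin 4), c' * ‖l • y‖ ^ (c' - 1) = L * (c' * ‖y‖ ^ (c' - 1)) := by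
    intro y
    rw [norm_smul, Real.norm_of_nonneg hl0.le, Real.mul_rpow hl0.le (norm_nonneg _), hL]
    ring
  -- the dilated function `W = w(l ·)`
  have hW : ContDiff ℝ ∞ fun y : EuclideanSpace ℝ (Fin 4) ↦ w (l • y) := hw.comp (contDiff_const_smul l)
  have hWc : HasCompactSupport fun y : EuclideanSpace ℝ (Fin 4) ↦ w (l • y) := hwc.comp_smul hl0.ne'
  have hWs : tsupport (fun y : EuclideanSpace ℝ (Fin 4) ↦ w (l • y)) ⊆ {x | 1 < ‖x‖} := by
    have h2 : support (fun y : EuclideanSpace ℝ (Fin 4) ↦ w (l • y)) ⊆ {y | 2 ≤ ‖y‖} := by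
      intro y hy
      have h : a ≤ ‖l • y‖ := hws (subset_tsupport _ (mem_support.2 hy))
      rw [norm_smul, Real.norm_of_nonneg hl0.le, hl] at h
      show 2 ≤ ‖y‖
      by_contra hlt
      push Not at hlt
      have := mul_lt_mul_of_pos_left hlt (half_pos ha)
      linarith
    refine (closure_minimal h2 (isClosed_le continuous_const continuous_norm)).trans fun y hy ↦ ?_
    show 1 < ‖y‖
    have : (2 : ℝ) ≤ ‖y‖ := hy
    linarith
  -- normalisation of `W` at scale `σ`
  have hnorm' := hnorm
  rw [RoundClauseEuclidean.integral_eq_pow_four_mul_integral_comp_smul _ hl0] at hnorm'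
  rw [← integral_const_mul] at hnorm'
  have hnormW : ∫ y, (4 * Real.pi * σ) ^ (-(4 : ℝ) / 2) * (w (l • y)) ^ 2 *
      (c' * ‖y‖ ^ (c' - 1)) ^ 4 = 1 := by
    refine (integral_congr_ae (ae_of_all _ fun y ↦ ?_)).trans hnorm'
    rw [hψl, hkσ]
    ring
  have key := hfar σ hσ0 _ hW hWc hWs hnormW
  -- undo the dilation on the right-hand side
  refine key.trans_eq ?_
  rw [RoundClauseEuclidean.integral_eq_pow_four_mul_integral_comp_smul
      (fun x ↦ (4 * τ * ((c' * ‖x‖ ^ (c' - 1))⁻¹ ^ 2 * ‖gradient w x‖ ^ 2)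
        - (w x) ^ 2 * Real.log ((w x) ^ 2) - 4 * (w x) ^ 2)
        * ((4 * Real.pi * τ) ^ (-(4 : ℝ) / 2) * (c' * ‖x‖ ^ (c' - 1)) ^ 4)) hl0,
    ← integral_const_mul]
  refine integral_congr_ae (ae_of_all _ fun y ↦ ?_)
  dsimp only
  rw [RoundClauseEuclidean.gradient_comp_smul, norm_smul, Real.norm_of_nonneg hl0.le, hψl, hkσ, hσ]
  have hl1 : l ≠ 0 := hl0.ne'
  have hL1 : L ≠ 0 := hL0.ne'
  by_cases hr : c' * ‖y‖ ^ (c' - 1) = 0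
  · rw [hr]
    simp
  · field_simp

end AnnulusConeFloor

/-- **Aux helper `helper_helper_annulusConeFloor_cone` (registered) — the exact-cone floor in the
`x`-picture.** Under the Balogh–Kristály–Tripaldi scale-family log-Sobolev inequality for complete
`Ric ≥ 0` four-manifolds of asymptotic volume ratio `θ` (hypothesis) and the smoothed cone model of
slope `c' ∈ (0, 1]` on `ℝ⁴` (hypothesis: `AVR = c'³`, equal to the exact cone `(c'‖x‖^{c'−1})² δ`
on `{1 ≤ ‖x‖}`), Perelman's `𝒲`-clause in `w²`-form for the weight `ψ = c'‖x‖^{c'−1}` holds at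
level `3 log c'` for all scales `τ > 0` and all smooth compactly supported `w` vanishing near the
vertex (`tsupport w ⊆ {a ≤ ‖x‖}`, `a > 0`): `∫ (4πτ)⁻² w² ψ⁴ = 1 ⇒
3 log c' ≤ ∫ [4τ ψ⁻² ‖∇w‖² − w² log w² − 4 w²] (4πτ)⁻² ψ⁴ dx`.
[cite: BaloghKristalyTripaldi2024, Thm. 1.1] -/
theorem helper_helper_annulusConeFloor_cone :
    (∀ (P : Type) [TopologicalSpace P] [T2Space P] [SecondCountableTopology P]
      [ChartedSpace (EuclideanSpace ℝ (Fin 4)) P] [IsManifold (𝓡 4) ∞ P] [ConnectedSpace P]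
      [T3Space P] [MeasurableSpace P] [BorelSpace P]
      (h : PseudoRiemannianMetric (𝓡 4) ∞ (EuclideanSpace ℝ (Fin 4)) (TangentSpace (𝓡 4) : P → Type _))
      [h.HasLeviCivita] (hh : h.IsRiemannian) (θ : ℝ),
      (∀ (x : P) (r : NNReal), IsCompact {y : P | h.edist hh x y ≤ r}) →
      (∀ (x : P) (X : TangentSpace (𝓡 4) x), 0 ≤ h.ricci x X X) → 0 < θ →
      (∀ x : P, Tendsto (fun r : ℝ ↦
        ((riemannianMeasure (h.toContMDiffRiemannianMetric hh))
          {y : P | h.edist hh x y ≤ ENNReal.ofReal r}).toReal / (Real.pi ^ 2 / 2 * r ^ 4))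
        atTop (𝓝 θ)) →
      ∀ u : P → ℝ, ContMDiff (𝓡 4) 𝓘(ℝ, ℝ) ∞ u → HasCompactSupport u →
        ∫ x, (u x) ^ 2 ∂(riemannianMeasure (h.toContMDiffRiemannianMetric hh)) = 1 →
        ∀ τ : ℝ, 0 < τ →
          ∫ x, (u x) ^ 2 * Real.log ((u x) ^ 2) ∂(riemannianMeasure (h.toContMDiffRiemannianMetric hh)) ≤
            4 * τ * ∫ x, h.gradSq u x ∂(riemannianMeasure (h.toContMDiffRiemannianMetric hh))
              - Real.log θ - 2 * Real.log (4 * Real.pi * τ) - 4) →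
    (∀ c' : ℝ, 0 < c' → c' ≤ 1 →
      ∃ gc : PseudoRiemannianMetric (𝓡 4) ∞ (EuclideanSpace ℝ (Fin 4))
          (TangentSpace (𝓡 4) : EuclideanSpace ℝ (Fin 4) → Type _),
      ∃ _ : gc.HasLeviCivita, ∃ hgc : gc.IsRiemannian,
        (∀ (x : EuclideanSpace ℝ (Fin 4)) (r : NNReal),
          IsCompact {y : EuclideanSpace ℝ (Fin 4) | gc.edist hgc x y ≤ r}) ∧
        (∀ (x : EuclideanSpace ℝ (Fin 4)) (X : TangentSpace (𝓡 4) x), 0 ≤ gc.ricci x X X) ∧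
        (∀ x : EuclideanSpace ℝ (Fin 4), Tendsto (fun r : ℝ ↦
          ((riemannianMeasure (gc.toContMDiffRiemannianMetric hgc))
            {y : EuclideanSpace ℝ (Fin 4) | gc.edist hgc x y ≤ ENNReal.ofReal r}).toReal /
              (Real.pi ^ 2 / 2 * r ^ 4)) atTop (𝓝 (c' ^ 3))) ∧
        ∀ x : EuclideanSpace ℝ (Fin 4), 1 ≤ ‖x‖ → ∀ v w : EuclideanSpace ℝ (Fin 4),
          gc.val x v w = (c' * ‖x‖ ^ (c' - 1)) ^ 2 * ⟪v, w⟫) →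
    ∀ c' : ℝ, 0 < c' → c' ≤ 1 → ∀ a : ℝ, 0 < a → ∀ τ : ℝ, 0 < τ →
      ∀ w : EuclideanSpace ℝ (Fin 4) → ℝ, ContDiff ℝ ∞ w → HasCompactSupport w →
        tsupport w ⊆ {x | a ≤ ‖x‖} →
        ∫ x, (4 * Real.pi * τ) ^ (-(4 : ℝ) / 2) * (w x) ^ 2 * (c' * ‖x‖ ^ (c' - 1)) ^ 4 = 1 →
          3 * Real.log c' ≤
            ∫ x, (4 * τ * ((c' * ‖x‖ ^ (c' - 1))⁻¹ ^ 2 * ‖gradient w x‖ ^ 2)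
                - (w x) ^ 2 * Real.log ((w x) ^ 2) - 4 * (w x) ^ 2)
                * ((4 * Real.pi * τ) ^ (-(4 : ℝ) / 2) * (c' * ‖x‖ ^ (c' - 1)) ^ 4) := by
  intro hBKT hmodel c' hc' hc1 a ha τ hτ w hw hwc hws hnorm
  have hLSe := helper_helper_annulusConeFloor_model hBKT hmodel c' hc' hc1
  exact AnnulusConeFloor.coneFloor_dilate hc'
    (fun σ hσ W hW hWc hWs hN ↦ AnnulusConeFloor.coneFloor_far hc' hLSe hW hWc hWs hσ hN)
    ha hτ hw hwc hws hnorm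

end Summit.SmoothPoincare4.SmoothPoincare4.Theorems

end
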